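import Literature.Computability.AlgebraicComplexity.BLMW11KroneckerApproximation
import HarnessLib

/-!
# BLMW 2011 §9.1: a weakly-skew circuit computes a polynomial of degree at most its size

[cite: BurgisserEtAl2011, §9.1 (VP_ws)] — P. Bürgisser, J. M. Landsberg, L. Manivel, J. Weyman,
*An overview of mathematical issues arising in the geometric complexity theory approach to
`VP ≠ VNP`*, SIAM J. Comput. 40 (2011), §9.1, the sentence typed as the justification for the
absence of a degree clause in the tree's `IsVPwsFamily` (`BLMW11KroneckerApproximation.lean`):
"the degree of the polynomial computed by a weakly-skew circuit is bounded by its size".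

This is the POSITIVE twin of the cell's erratum A14: for the unguarded notion (circuits with junk
forward gate references) the sentence failed — repeated squaring `x^(2^n)` was "weakly skew" of
size `2n` — and the defining sets of `wsComplexity` / `skewComplexity` were corrected to
well-formed circuits (`ArithCircuit.WellFormed`). Here we certify the sentence for the corrected
notion:

* `ArithCircuit.subcircuit_le` — in a well-formed circuit the sub-circuit of gate `j` lies below
  `j`; `ArithCircuit.disjoint_subcircuit_of_isSeparateOperand` — the unique-exit-edge condition
  of §9.1 makes the sub-circuit of a separate multiplicand DISJOINT from the sub-circuit of the
  other factor;
* `ArithCircuit.totalDegree_gateValue_le` — gate `j` of a well-formed fan-in-two weakly-skew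
  circuit computes a polynomial of total degree `≤ |sub-circuit of j| + 1` (strong induction; at a
  product gate the two factor sub-circuits are disjoint and proper);
* `ArithCircuit.totalDegree_eval_le_of_isWeaklySkew` — hence `deg P.eval ≤ P.size + 1` (the `+1`
  because the tree's `size` counts gates only, BLMW's size counts the input vertices too);
* `isPBounded_totalDegree_of_isVPwsFamily` — a `VP_ws` family (corrected notion) whose members do
  have weakly-skew circuits has p-bounded degree.
* §Laminar (appended): the public structure lemmas of the laminar family of separate modules —
  `ArithCircuit.eq_of_references_of_isSeparateOperand` (unique entry edge),
  `ArithCircuit.mem_subcircuit_of_isSeparateOperand` (paths into `C_γ` pass through `δ`),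
  `ArithCircuit.subcircuit_subset_or_subset_or_disjoint` (laminarity against every sub-circuit),
  `ArithCircuit.disjoint_subcircuit_of_not_mem` (distinct same-level modules are disjoint), and
  small companions, for the `(iii)` (`L_skew ≤ c · L_ws`) surgery.
* §Truncate (appended): `ArithCircuit.isWeaklySkew_take` (a prefix of a well-formed weakly-skew
  circuit is weakly skew) and `ArithCircuit.exists_output_last` (w.l.o.g. the output is the last
  gate, which lies in no separate module).

Theorems only, no named facts, no `sorry` (D-0026). Honest framing: a textbook property of the
model, vocabulary hygiene for row BLMW2011-B of the `val-lit` cell; `VP ≠ VNP` is NOT proved and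
nothing here bears on it.
-/

namespace Literature.Computability.AlgebraicComplexity

namespace ArithCircuit

open MvPolynomial

section Structure

variable {k : Type*} {σ : Type*} (P : ArithCircuit k σ)

/-- `j ∈ g.refs` iff `gate j` is an operand of `g`. [cite: BurgisserEtAl2011, §9.1] -/
theorem mem_refs_iff (g : Gate k σ) (j : ℕ) : j ∈ g.refs ↔ Operand.gate j ∈ g.args := by
  unfold Gate.refs
  rw [List.mem_filterMap]
  constructor
  · rintro ⟨u, hu, h⟩
    cases u with
    | var i => simp at h
    | const c => simp at h
    | gate j' =>
      simp only [Option.some.injEq] at h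
      subst h
      exact hu
  · intro h
    exact ⟨.gate j, h, rfl⟩

/-- In a well-formed circuit a gate references earlier gates only. [cite: Burgisser2000, Def. 2.1] -/
theorem lt_of_references (hwf : P.WellFormed) {l j : ℕ} (h : P.References l j) : j < l := by
  obtain ⟨g, hg, hj⟩ := h
  have := hwf.1 l g hg (.gate j) ((mem_refs_iff g j).1 hj)
  exact this

/-- **In a well-formed circuit the sub-circuit of `j` lies below `j`.**
[cite: BurgisserEtAl2011, §9.1 (the subcircuit C_α)] -/
theorem subcircuit_le (hwf : P.WellFormed) {j l : ℕ} (h : l ∈ P.subcircuit j) : l ≤ j := by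
  change Relation.ReflTransGen _ _ _ at h
  induction h with
  | refl => exact le_rfl
  | tail _ hbc ih => exact (lt_of_references P hwf hbc).le.trans ih

/-- The sub-circuit of `j` is finite (well-formed case). [cite: BurgisserEtAl2011, §9.1] -/
theorem subcircuit_finite (hwf : P.WellFormed) (j : ℕ) : (P.subcircuit j).Finite :=
  (Set.finite_Iic j).subset fun _ hl => subcircuit_le P hwf hl

/-- `j` lies in its own sub-circuit. [cite: BurgisserEtAl2011, §9.1] -/
theorem self_mem_subcircuit (j : ℕ) : j ∈ P.subcircuit j :=
  Relation.ReflTransGen.refl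

/-- The sub-circuit of a referenced gate is part of the sub-circuit of the referencing gate.
[cite: BurgisserEtAl2011, §9.1] -/
theorem subcircuit_subset_of_references {α β : ℕ} (h : P.References α β) :
    P.subcircuit β ⊆ P.subcircuit α :=
  fun _ hl => Relation.ReflTransGen.head h hl

/-- The sub-circuit of `j` has at most `j + 1` gates (well-formed case).
[cite: BurgisserEtAl2011, §9.1] -/
theorem ncard_subcircuit_le (hwf : P.WellFormed) (j : ℕ) : (P.subcircuit j).ncard ≤ j + 1 := by
  have hsub : P.subcircuit j ⊆ ((Finset.range (j + 1) : Finset ℕ) : Set ℕ) := fun l hl => by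
    rw [Finset.coe_range]
    exact Nat.lt_succ_of_le (subcircuit_le P hwf hl)
  calc (P.subcircuit j).ncard ≤ (((Finset.range (j + 1) : Finset ℕ)) : Set ℕ).ncard :=
        Set.ncard_le_ncard hsub (Finset.finite_toSet _)
    _ = j + 1 := by rw [Set.ncard_coe_finset, Finset.card_range]

/-- A path that starts outside a set and ends inside it crosses its boundary along an edge.
[folklore] -/
private theorem exists_crossing {α : Type*} {R : α → α → Prop} {S : Set α} {a b : α}
    (h : Relation.ReflTransGen R a b) (ha : a ∉ S) (hb : b ∈ S) :
    ∃ y y', Relation.ReflTransGen R a y ∧ R y y' ∧ y ∉ S ∧ y' ∈ S := by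
  induction h with
  | refl => exact absurd hb ha
  | tail hac hcb ih =>
    rename_i c b'
    by_cases hc : c ∈ S
    · exact ih hc
    · exact ⟨c, b', hac, hcb, hc, hb⟩

/-- **The unique-exit-edge condition makes the factor sub-circuits disjoint.** If `gate β` is a
separate operand of gate `α` (BLMW §9.1: the edge `β → α` is the only edge leaving `C_β`) and
`γ ≠ β` is another gate referenced by `α`, then `C_β ∩ C_γ = ∅` (well-formed circuits).
[cite: BurgisserEtAl2011, §9.1 (weakly-skew circuits)] -/
theorem disjoint_subcircuit_of_isSeparateOperand (hwf : P.WellFormed) {α β γ : ℕ}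
    (hsep : P.IsSeparateOperand α β) (hβ : P.References α β) (hγ : P.References α γ)
    (hne : γ ≠ β) : Disjoint (P.subcircuit β) (P.subcircuit γ) := by
  obtain ⟨gα, hgα, hγrefs⟩ := hγ
  have hαβ : α ∉ P.subcircuit β := fun h =>
    lt_irrefl α ((subcircuit_le P hwf h).trans_lt (lt_of_references P hwf hβ))
  -- `γ` itself is outside `C_β`
  have hγβ : γ ∉ P.subcircuit β := fun h => by
    have hc := hsep α hαβ gα hgα γ h
    rw [if_neg (fun h' => hne h'.2)] at hc
    exact (List.count_eq_zero.1 hc) hγrefs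
  rw [Set.disjoint_iff]
  rintro x ⟨hxβ, hxγ⟩
  -- a path `γ →* x` enters `C_β` along some edge `y → y'` with `y ∉ C_β`; but `y ≠ α`
  obtain ⟨y, y', hγy, ⟨gy, hgy, hy'⟩, hy, hy'β⟩ := exists_crossing hxγ hγβ hxβ
  have hc := hsep y hy gy hgy y' hy'β
  have hyα : y ≠ α := by
    intro h
    subst h
    have h1 : y ≤ γ := subcircuit_le P hwf hγy
    have h2 : γ < y := lt_of_references P hwf ⟨gα, hgα, hγrefs⟩
    omega
  rw [if_neg (fun h' => hyα h'.1)] at hc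
  exact (List.count_eq_zero.1 hc) hy'

/-- Counting: if gate `α` references `β`, then `|C_α| ≥ |C_β| + 1` (well-formed case).
[cite: BurgisserEtAl2011, §9.1] -/
theorem ncard_subcircuit_succ_le (hwf : P.WellFormed) {α β : ℕ} (h : P.References α β) :
    (P.subcircuit β).ncard + 1 ≤ (P.subcircuit α).ncard := by
  have hα : α ∉ P.subcircuit β := fun h' =>
    lt_irrefl α ((subcircuit_le P hwf h').trans_lt (lt_of_references P hwf h))
  have hfin := subcircuit_finite P hwf β
  rw [← Set.ncard_insert_of_notMem hα hfin]
  refine Set.ncard_le_ncard ?_ (subcircuit_finite P hwf α)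
  rintro x (rfl | hx)
  · exact self_mem_subcircuit P _
  · exact subcircuit_subset_of_references P h hx

/-- Counting at a product gate with a separate multiplicand: `|C_α| ≥ |C_β| + |C_γ| + 1`.
[cite: BurgisserEtAl2011, §9.1 (weakly-skew circuits)] -/
theorem ncard_subcircuit_add_le (hwf : P.WellFormed) {α β γ : ℕ} (hsep : P.IsSeparateOperand α β)
    (hβ : P.References α β) (hγ : P.References α γ) (hne : γ ≠ β) :
    (P.subcircuit β).ncard + (P.subcircuit γ).ncard + 1 ≤ (P.subcircuit α).ncard := by
  have hdisj := disjoint_subcircuit_of_isSeparateOperand P hwf hsep hβ hγ hne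
  have hfinβ := subcircuit_finite P hwf β
  have hfinγ := subcircuit_finite P hwf γ
  have hα : α ∉ P.subcircuit β ∪ P.subcircuit γ := by
    rintro (h | h)
    · exact lt_irrefl α ((subcircuit_le P hwf h).trans_lt (lt_of_references P hwf hβ))
    · exact lt_irrefl α ((subcircuit_le P hwf h).trans_lt (lt_of_references P hwf hγ))
  rw [← Set.ncard_union_eq hdisj hfinβ hfinγ,
    ← Set.ncard_insert_of_notMem hα (hfinβ.union hfinγ)]
  refine Set.ncard_le_ncard ?_ (subcircuit_finite P hwf α)
  rintro x (rfl | hx | hx)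
  · exact self_mem_subcircuit P _
  · exact subcircuit_subset_of_references P hβ hx
  · exact subcircuit_subset_of_references P hγ hx

end Structure

/-! ## Values and degrees -/

section Degree

variable {k : Type*} [CommSemiring k] {σ : Type*}

/-- Evaluating a longer gate list extends the list of values. [cite: Burgisser2000, Def. 2.1] -/
private theorem exists_gateValues_append_eq (l₁ l₂ : List (Gate k σ)) :
    ∃ r, gateValues (l₁ ++ l₂) = gateValues l₁ ++ r ∧ r.length = l₂.length := by
  induction l₂ using List.reverseRecOn with
  | nil => exact ⟨[], by simp, rfl⟩
  | append_singleton l₂ g ih =>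
    obtain ⟨r, hr, hlen⟩ := ih
    refine ⟨r ++ [g.eval (gateValues (l₁ ++ l₂))], ?_, by simp [hlen]⟩
    rw [← List.append_assoc, gateValues_append_singleton, hr, List.append_assoc]

/-- The value of gate `p` is its evaluation against the values of the earlier gates.
[cite: Burgisser2000, Def. 2.1] -/
private theorem getD_gateValues (gs : List (Gate k σ)) (p : ℕ) (g : Gate k σ)
    (hg : gs[p]? = some g) :
    (gateValues gs).getD p 0 = g.eval (gateValues (gs.take p)) := by
  obtain ⟨hp, hpg⟩ := List.getElem?_eq_some_iff.1 hg
  have hsplit : gs = (gs.take p ++ [g]) ++ gs.drop (p + 1) := by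
    rw [List.append_assoc, List.singleton_append, ← hpg, ← List.drop_eq_getElem_cons hp,
      List.take_append_drop]
  obtain ⟨r, hr, -⟩ := exists_gateValues_append_eq (gs.take p ++ [g]) (gs.drop (p + 1))
  rw [← hsplit, gateValues_append_singleton] at hr
  have hlen : (gateValues (gs.take p)).length = p := by
    rw [gateValues_length, List.length_take]
    omega
  rw [List.getD_eq_getElem?_getD, hr, List.append_assoc, List.getElem?_append_right (by omega),
    hlen, Nat.sub_self]
  simp

/-- Earlier values seen from gate `p` are the final values. [cite: Burgisser2000, Def. 2.1] -/
private theorem getD_gateValues_take (gs : List (Gate k σ)) {i p : ℕ} (hi : i < p) :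
    (gateValues (gs.take p)).getD i 0 = (gateValues gs).getD i 0 := by
  obtain ⟨r, hr, -⟩ := exists_gateValues_append_eq (gs.take p) (gs.drop p)
  rw [List.take_append_drop] at hr
  rw [hr, List.getD_eq_getElem?_getD, List.getD_eq_getElem?_getD]
  by_cases hi' : i < (gateValues (gs.take p)).length
  · rw [List.getElem?_append_left hi']
  · have hlen : (gateValues (gs.take p)).length = min p gs.length := by
      rw [gateValues_length, List.length_take]
    have htake : gs.take p = gs := List.take_of_length_le (by omega)
    rw [htake] at hr ⊢
    have hr' : r = [] := by
      have h := congrArg List.length hr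
      simp only [List.length_append] at h
      exact List.eq_nil_of_length_eq_zero (by omega)
    rw [hr', List.append_nil]

/-- Degrees of a list sum. [folklore] -/
private theorem totalDegree_list_sum_le {l : List (MvPolynomial σ k)} {n : ℕ}
    (h : ∀ x ∈ l, x.totalDegree ≤ n) : l.sum.totalDegree ≤ n := by
  induction l with
  | nil => simp
  | cons a l ih =>
    rw [List.sum_cons]
    refine (totalDegree_add a l.sum).trans (max_le (h a (by simp)) (ih fun x hx => h x (by simp [hx])))

variable (P : ArithCircuit k σ)

/-- **Gate `j` of a well-formed fan-in-two weakly-skew circuit computes a polynomial of total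
degree at most `|C_j| + 1`.** (At a product gate `α = u·u'`: an input factor has degree `≤ 1`; a
separate multiplicand `β` and the other gate factor `γ` have disjoint proper sub-circuits, so
`(|C_β|+1) + (|C_γ|+1) ≤ |C_α| + 1`.) [cite: BurgisserEtAl2011, §9.1 (VP_ws)] -/
theorem totalDegree_gateValue_le (hwf : P.WellFormed) (h2 : P.IsFanInTwo) (hws : P.IsWeaklySkew) :
    ∀ j : ℕ, j < P.size →
      ((gateValues P.gates).getD j 0).totalDegree ≤ (P.subcircuit j).ncard + 1 := by
  intro j
  induction j using Nat.strong_induction_on with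
  | _ j ih =>
  intro hj
  obtain ⟨g, hg⟩ : ∃ g, P.gates[j]? = some g := ⟨P.gates[j]'hj, List.getElem?_eq_getElem hj⟩
  rw [getD_gateValues P.gates j g hg]
  have hone : 1 ≤ (P.subcircuit j).ncard :=
    (Set.ncard_pos (subcircuit_finite P hwf j)).2 ⟨j, self_mem_subcircuit P j⟩
  -- degree of an INPUT operand of `g`: at most `1`
  have hopIn : ∀ u ∈ g.args, u.isGateRef = false →
      (u.eval (gateValues (P.gates.take j))).totalDegree ≤ 1 := by
    intro u _ hin
    cases u with
    | var i => exact (isHomogeneous_X k i).totalDegree_le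
    | const c => simp [Operand.eval]
    | gate i => simp [Operand.isGateRef] at hin
  -- degree of a GATE operand `gate i` of `g`: at most `|C_i| + 1 ≤ |C_j|`
  have hopGate : ∀ i : ℕ, Operand.gate i ∈ g.args →
      ((Operand.gate i : Operand k σ).eval (gateValues (P.gates.take j))).totalDegree ≤
        (P.subcircuit j).ncard := by
    intro i hu
    have hub : i < j := hwf.1 j g hg (.gate i) hu
    simp only [Operand.eval_gate]
    rw [getD_gateValues_take P.gates hub]
    have href : P.References j i := ⟨g, hg, (mem_refs_iff g i).2 hu⟩
    have h1 := ih i hub (hub.trans hj)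
    have h2 := ncard_subcircuit_succ_le P hwf href
    omega
  have hop' : ∀ u ∈ g.args, (u.eval (gateValues (P.gates.take j))).totalDegree ≤
      (P.subcircuit j).ncard := by
    intro u hu
    cases u with
    | var i => exact (hopIn _ hu rfl).trans hone
    | const c => exact (hopIn _ hu rfl).trans hone
    | gate i => exact hopGate i hu
  cases g with
  | sum args =>
    -- a sum gate: degree ≤ max over its operands
    simp only [Gate.eval]
    refine (totalDegree_list_sum_le (n := (P.subcircuit j).ncard) fun x hx => ?_).trans (by omega)
    obtain ⟨a, ha, rfl⟩ := List.mem_map.1 hx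
    refine (totalDegree_smul_le _ _).trans (hop' a.2 ?_)
    simp only [Gate.args]
    exact List.mem_map.2 ⟨a, ha, rfl⟩
  | prod args =>
    have hfan : args.length ≤ 2 := by
      have := h2 (.prod args) (List.mem_of_getElem? hg)
      simpa [Gate.fanIn, Gate.args] using this
    simp only [Gate.eval]
    rcases args with _ | ⟨u₁, _ | ⟨u₂, _ | ⟨u₃, rest⟩⟩⟩
    · simp
    · simp only [List.map_cons, List.map_nil, List.prod_cons, List.prod_nil, mul_one]
      exact (hop' u₁ (by simp [Gate.args])).trans (by omega)
    · simp only [List.map_cons, List.map_nil, List.prod_cons, List.prod_nil, mul_one]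
      refine (totalDegree_mul _ _).trans ?_
      -- the weakly-skew witness among `u₁`, `u₂`
      obtain ⟨u, hu, hcase⟩ := hws j [u₁, u₂] hg (by simp)
      -- symmetric bookkeeping: the witness `u` and the other operand `u'`
      have key : ∀ u u' : Operand k σ, (u = u₁ ∧ u' = u₂ ∨ u = u₂ ∧ u' = u₁) →
          (u.isGateRef = false ∨ ∃ i, u = .gate i ∧ P.IsSeparateOperand j i) →
          (u.eval (gateValues (P.gates.take j))).totalDegree +
            (u'.eval (gateValues (P.gates.take j))).totalDegree ≤ (P.subcircuit j).ncard + 1 := by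
        intro u u' huu' hcase
        have hu : u ∈ (Gate.prod [u₁, u₂]).args := by
          rcases huu' with ⟨h1, -⟩ | ⟨h1, -⟩ <;> simp [Gate.args, h1]
        have hu' : u' ∈ (Gate.prod [u₁, u₂]).args := by
          rcases huu' with ⟨-, h1⟩ | ⟨-, h1⟩ <;> simp [Gate.args, h1]
        rcases hcase with hinp | ⟨β, rfl, hsep⟩
        · -- `u` is an input: degree ≤ 1
          have h1 := hopIn u hu hinp
          have h2' := hop' u' hu'
          omega
        · -- `u = gate β`, a separate operand; case on the other operand
          have hβref : P.References j β := ⟨_, hg, (mem_refs_iff _ β).2 hu⟩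
          have hβlt : β < j := lt_of_references P hwf hβref
          have hdegβ : ((Operand.gate β : Operand k σ).eval
              (gateValues (P.gates.take j))).totalDegree ≤ (P.subcircuit β).ncard + 1 := by
            simp only [Operand.eval_gate]
            rw [getD_gateValues_take P.gates hβlt]
            exact ih β hβlt (hβlt.trans hj)
          cases u' with
          | var i =>
            have : ((Operand.var i : Operand k σ).eval (gateValues (P.gates.take j))).totalDegree
                ≤ 1 := (isHomogeneous_X k i).totalDegree_le
            have := ncard_subcircuit_succ_le P hwf hβref
            omega
          | const c =>
            have : ((Operand.const c : Operand k σ).eval (gateValues (P.gates.take j))).totalDegree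
                = 0 := by simp [Operand.eval]
            have := ncard_subcircuit_succ_le P hwf hβref
            omega
          | gate γ =>
            have hγref : P.References j γ := ⟨_, hg, (mem_refs_iff _ γ).2 hu'⟩
            have hγlt : γ < j := lt_of_references P hwf hγref
            have hdegγ : ((Operand.gate γ : Operand k σ).eval
                (gateValues (P.gates.take j))).totalDegree ≤ (P.subcircuit γ).ncard + 1 := by
              simp only [Operand.eval_gate]
              rw [getD_gateValues_take P.gates hγlt]
              exact ih γ hγlt (hγlt.trans hj)
            -- `γ ≠ β`: otherwise `β` would be referenced twice by gate `j`
            have hne : γ ≠ β := by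
              intro hγβ
              subst hγβ
              have hjγ : j ∉ P.subcircuit γ := fun h =>
                lt_irrefl j ((subcircuit_le P hwf h).trans_lt hβlt)
              have hc := hsep j hjγ _ hg γ (self_mem_subcircuit P γ)
              rw [if_pos ⟨rfl, rfl⟩] at hc
              have h2c : (Gate.prod [u₁, u₂]).refs.count γ = 2 := by
                rcases huu' with ⟨h1, h2⟩ | ⟨h1, h2⟩ <;> rw [← h1, ← h2] <;>
                  simp [Gate.refs, Gate.args]
              omega
            have := ncard_subcircuit_add_le P hwf hsep hβref hγref hne
            omega
      simp only [List.mem_cons, List.not_mem_nil, or_false] at hu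
      rcases hu with hu | hu
      · have h := key u u₂ (Or.inl ⟨hu, rfl⟩) hcase
        rw [hu] at h
        exact h
      · have h := key u u₁ (Or.inr ⟨hu, rfl⟩) hcase
        rw [hu, add_comm] at h
        exact h
    · simp at hfan

/-- **BLMW 2011 §9.1: "the degree of the polynomial computed by a weakly-skew circuit is bounded
by its size"** — for the corrected (well-formed, fan-in-two) notion: `deg P.eval ≤ P.size + 1`
(the tree's `size` counts gates only; BLMW's also counts the input vertices, whence the `+1`).
[cite: BurgisserEtAl2011, §9.1 (VP_ws)] -/
theorem totalDegree_eval_le_of_isWeaklySkew (hwf : P.WellFormed) (h2 : P.IsFanInTwo)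
    (hws : P.IsWeaklySkew) : P.eval.totalDegree ≤ P.size + 1 := by
  unfold ArithCircuit.eval
  have hout := hwf.2
  cases ho : P.output with
  | var i => exact (isHomogeneous_X k i).totalDegree_le.trans (by omega)
  | const c => simp [Operand.eval]
  | gate j =>
    rw [ho] at hout
    change j < P.size at hout
    rw [Operand.eval_gate]
    exact (totalDegree_gateValue_le P hwf h2 hws j hout).trans
      (by have := ncard_subcircuit_le P hwf j; omega)

end Degree

end ArithCircuit

/-! ## The class `VP_ws` (corrected notion) has p-bounded degree -/

section Classes

open MvPolynomial

/-- **A `VP_ws` family has polynomially bounded degree** (BLMW 2011 §9.1, the reason no degree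
clause appears in the definition of `VP_ws`), for the corrected notion of `wsComplexity`
(well-formed circuits), provided each member is computed by SOME well-formed fan-in-two weakly-skew
circuit (so that `L_ws(f_n)` is attained, `exists_size_eq_wsComplexity`; without a circuit the
tree's `wsComplexity` is the junk value `0`). [cite: BurgisserEtAl2011, §9.1 (VP_ws)] -/
theorem isPBounded_totalDegree_of_isVPwsFamily {k : Type*} [CommSemiring k] {σ : ℕ → Type*}
    {f : ∀ n, MvPolynomial (σ n) k} (hf : IsVPwsFamily f)
    (hex : ∀ n, ∃ P : ArithCircuit k (σ n),
      P.WellFormed ∧ P.IsFanInTwo ∧ P.IsWeaklySkew ∧ P.Computes (f n)) :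
    IsPBounded fun n => (f n).totalDegree := by
  obtain ⟨c, hc⟩ := hf
  refine ⟨c + 2, fun n => ?_⟩
  obtain ⟨P, hwf, h2, hws, hcomp, hsize⟩ := exists_size_eq_wsComplexity (hex n)
  have hP := ArithCircuit.totalDegree_eval_le_of_isWeaklySkew P hwf h2 hws
  rw [hcomp] at hP
  have hcn : wsComplexity (f n) ≤ n ^ c + c := hc n
  have h1 : n ^ c + c + 1 ≤ n ^ (c + 2) + (c + 2) := by
    rcases Nat.eq_zero_or_pos n with rfl | hn
    · have h0 : (0 : ℕ) ^ (c + 2) = 0 := by simp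
      have h0' : (0 : ℕ) ^ c ≤ 1 := by cases c <;> simp
      rw [h0]
      omega
    · have := Nat.pow_le_pow_right hn (show c ≤ c + 2 by omega)
      omega
  calc (f n).totalDegree ≤ P.size + 1 := hP
    _ = wsComplexity (f n) + 1 := by rw [hsize]
    _ ≤ n ^ (c + 2) + (c + 2) := by omega

end Classes

/-! ## The laminar structure of separate sub-circuits (BLMW 2011 §9.1; Malod–Portier)

Public structure lemmas for the `(iii)`-type circuit surgery on weakly-skew circuits (a separate
multiplicand's sub-circuit is a MODULE entered through one edge): unique entry, "every path from
outside into `C_γ` passes through its product gate", laminarity against every sub-circuit,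
disjointness of distinct same-level modules. [cite: BurgisserEtAl2011, §9.1 (weakly-skew circuits)] -/

namespace ArithCircuit

section Laminar

variable {k : Type*} {σ : Type*} (P : ArithCircuit k σ)

/-- A gate operand `gate j` of gate `l` is an edge `j → l`. [cite: BurgisserEtAl2011, §9.1] -/
theorem references_of_mem_args {l j : ℕ} {g : Gate k σ} (hg : P.gates[l]? = some g)
    (h : Operand.gate j ∈ g.args) : P.References l j :=
  ⟨g, hg, (mem_refs_iff g j).2 h⟩

/-- Sub-circuits are closed under references. [cite: BurgisserEtAl2011, §9.1 (the subcircuit C_α)] -/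
theorem mem_subcircuit_of_references {i l j : ℕ} (hl : l ∈ P.subcircuit i)
    (h : P.References l j) : j ∈ P.subcircuit i :=
  Relation.ReflTransGen.tail hl h

/-- Sub-circuits are transitive: `i ∈ C_j ⇒ C_i ⊆ C_j`. [cite: BurgisserEtAl2011, §9.1] -/
theorem subcircuit_subset_of_mem {i j : ℕ} (h : i ∈ P.subcircuit j) :
    P.subcircuit i ⊆ P.subcircuit j :=
  fun _ hx => Relation.ReflTransGen.trans h hx

/-- `C_j ⊆ [0, j]` in a well-formed circuit (= `subcircuit_le`). [cite: BurgisserEtAl2011, §9.1] -/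
theorem subcircuit_subset_Iic (hwf : P.WellFormed) (j : ℕ) : P.subcircuit j ⊆ Set.Iic j :=
  fun _ hl => subcircuit_le P hwf hl

/-- A referencing gate lies outside the sub-circuit of the gate it references (well-formed case).
[cite: BurgisserEtAl2011, §9.1] -/
theorem not_mem_subcircuit_of_references (hwf : P.WellFormed) {l j : ℕ} (h : P.References l j) :
    l ∉ P.subcircuit j := fun h' =>
  lt_irrefl l ((subcircuit_le P hwf h').trans_lt (lt_of_references P hwf h))

/-- **Unique entry edge.** If `gate γ` is a separate operand of gate `δ`, the only edge from a gate
of `C_γ` to a gate outside `C_γ` is `γ → δ`. [cite: BurgisserEtAl2011, §9.1 (weakly-skew circuits)] -/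
theorem eq_of_references_of_isSeparateOperand {δ γ l j : ℕ} (hsep : P.IsSeparateOperand δ γ)
    (hl : l ∉ P.subcircuit γ) (hj : j ∈ P.subcircuit γ) (h : P.References l j) :
    l = δ ∧ j = γ := by
  obtain ⟨g, hg, hjg⟩ := h
  have hc := hsep l hl g hg j hj
  by_contra hne
  rw [if_neg hne] at hc
  exact (List.count_eq_zero.1 hc) hjg

/-- **Every path from outside into a separate module passes through its product gate**: if
`gate γ` is a separate operand of `δ`, `a ∉ C_γ` and some `l ∈ C_a ∩ C_γ`, then `δ ∈ C_a`.
[cite: BurgisserEtAl2011, §9.1 (weakly-skew circuits)] -/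
theorem mem_subcircuit_of_isSeparateOperand {δ γ a l : ℕ} (hsep : P.IsSeparateOperand δ γ)
    (ha : a ∉ P.subcircuit γ) (hal : l ∈ P.subcircuit a) (hlγ : l ∈ P.subcircuit γ) :
    δ ∈ P.subcircuit a := by
  obtain ⟨y, y', hay, hyy', hy, hy'⟩ := exists_crossing hal ha hlγ
  obtain ⟨rfl, -⟩ := eq_of_references_of_isSeparateOperand P hsep hy hy' hyy'
  exact hay

/-- **Laminarity.** The sub-circuit of a separate operand (one that is referenced by its product
gate) is nested in, contains, or is disjoint from EVERY sub-circuit `C_j`.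
[cite: BurgisserEtAl2011, §9.1 (weakly-skew circuits)] -/
theorem subcircuit_subset_or_subset_or_disjoint {δ γ : ℕ} (hsep : P.IsSeparateOperand δ γ)
    (hδ : P.References δ γ) (j : ℕ) :
    P.subcircuit γ ⊆ P.subcircuit j ∨ P.subcircuit j ⊆ P.subcircuit γ ∨
      Disjoint (P.subcircuit γ) (P.subcircuit j) := by
  by_cases h1 : γ ∈ P.subcircuit j
  · exact Or.inl (subcircuit_subset_of_mem P h1)
  by_cases h2 : j ∈ P.subcircuit γ
  · exact Or.inr (Or.inl (subcircuit_subset_of_mem P h2))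
  refine Or.inr (Or.inr (Set.disjoint_iff.2 ?_))
  rintro x ⟨hxγ, hxj⟩
  exact h1 (mem_subcircuit_of_references P (mem_subcircuit_of_isSeparateOperand P hsep h2 hxj hxγ) hδ)

/-- Laminarity, index form: if the modules of two referenced separate operands `γ₁` (of `δ₁`) and
`γ₂` (of `δ₂`) meet and `δ₂ < δ₁`, then `δ₂ ∈ C_{γ₁}` (well-formed case).
[cite: BurgisserEtAl2011, §9.1 (weakly-skew circuits)] -/
theorem mem_subcircuit_of_mem_of_mem_of_lt (hwf : P.WellFormed) {δ₁ γ₁ δ₂ γ₂ l : ℕ}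
    (h1 : P.IsSeparateOperand δ₁ γ₁) (hδ2 : P.References δ₂ γ₂)
    (hl1 : l ∈ P.subcircuit γ₁) (hl2 : l ∈ P.subcircuit γ₂) (hlt : δ₂ < δ₁) :
    δ₂ ∈ P.subcircuit γ₁ := by
  by_contra hout
  by_cases hγ : γ₂ ∈ P.subcircuit γ₁
  · obtain ⟨h, -⟩ := eq_of_references_of_isSeparateOperand P h1 hout hγ hδ2
    omega
  · have hδ12 := mem_subcircuit_of_isSeparateOperand P h1 hγ hl2 hl1
    have e1 := subcircuit_le P hwf hδ12
    have e2 := lt_of_references P hwf hδ2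
    omega

/-- **Distinct same-level modules are disjoint**: two referenced separate operands whose product
gates lie outside each other's module have disjoint modules (unless they are the same edge).
[cite: BurgisserEtAl2011, §9.1 (weakly-skew circuits)] -/
theorem disjoint_subcircuit_of_not_mem {δ₁ γ₁ δ₂ γ₂ : ℕ}
    (h1 : P.IsSeparateOperand δ₁ γ₁) (hδ1 : P.References δ₁ γ₁)
    (h2 : P.IsSeparateOperand δ₂ γ₂) (hδ2 : P.References δ₂ γ₂)
    (hne : ¬ (δ₁ = δ₂ ∧ γ₁ = γ₂)) (ho1 : δ₁ ∉ P.subcircuit γ₂) (ho2 : δ₂ ∉ P.subcircuit γ₁) :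
    Disjoint (P.subcircuit γ₁) (P.subcircuit γ₂) := by
  rcases subcircuit_subset_or_subset_or_disjoint P h1 hδ1 γ₂ with h | h | h
  · exact absurd (eq_of_references_of_isSeparateOperand P h2 ho1 (h (self_mem_subcircuit P γ₁))
      hδ1) hne
  · have h' := eq_of_references_of_isSeparateOperand P h1 ho2 (h (self_mem_subcircuit P γ₂)) hδ2
    exact absurd ⟨h'.1.symm, h'.2.symm⟩ hne
  · exact h

/-- A module `C_{γ'}` of a separate operand that contains an operand `β` of gate `δ` contains `δ`
itself — unless `β = γ'` is `δ`'s own separate operand (so the other factor of a product gate and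
the gate live at the same level of the laminar family). [cite: BurgisserEtAl2011, §9.1 (weakly-skew circuits)] -/
theorem mem_subcircuit_or_eq_of_isSeparateOperand {δ' γ' δ β : ℕ}
    (hsep : P.IsSeparateOperand δ' γ') (hβ : β ∈ P.subcircuit γ') (h : P.References δ β) :
    δ ∈ P.subcircuit γ' ∨ (δ = δ' ∧ β = γ') := by
  by_cases hδ : δ ∈ P.subcircuit γ'
  · exact Or.inl hδ
  · exact Or.inr (eq_of_references_of_isSeparateOperand P hsep hδ hβ h)

/-- In a weakly-skew circuit a product gate with two gate operands has a separate one.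
[cite: BurgisserEtAl2011, §9.1 (weakly-skew circuits)] -/
theorem isSeparateOperand_or_of_pair (hws : P.IsWeaklySkew) {δ β γ : ℕ}
    (hg : P.gates[δ]? = some (.prod [.gate β, .gate γ])) :
    P.IsSeparateOperand δ β ∨ P.IsSeparateOperand δ γ := by
  obtain ⟨u, hu, hcase⟩ := hws δ _ hg (by simp)
  simp only [List.mem_cons, List.not_mem_nil, or_false] at hu
  rcases hcase with hin | ⟨i, rfl, hsep⟩
  · rcases hu with rfl | rfl <;> simp [Operand.isGateRef] at hin
  · simp only [Operand.gate.injEq] at hu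
    rcases hu with rfl | rfl
    · exact Or.inl hsep
    · exact Or.inr hsep

/-- The two gate operands of a product gate with a separate operand are distinct gates
(the separate one is referenced exactly once). [cite: BurgisserEtAl2011, §9.1 (weakly-skew circuits)] -/
theorem ne_of_isSeparateOperand_of_pair (hwf : P.WellFormed) {δ β γ : ℕ}
    (hg : P.gates[δ]? = some (.prod [.gate β, .gate γ])) (hsep : P.IsSeparateOperand δ γ) :
    β ≠ γ := by
  intro hβγ
  subst hβγ
  have hδ : δ ∉ P.subcircuit β :=
    not_mem_subcircuit_of_references P hwf (references_of_mem_args P hg (by simp [Gate.args]))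
  have hc := hsep δ hδ _ hg β (self_mem_subcircuit P β)
  rw [if_pos ⟨rfl, rfl⟩] at hc
  have h2 : (Gate.prod [Operand.gate β, Operand.gate β] : Gate k σ).refs.count β = 2 := by
    simp [Gate.refs, Gate.args]
  omega

/-- Mirror form of `ne_of_isSeparateOperand_of_pair` (the FIRST operand separate).
[cite: BurgisserEtAl2011, §9.1 (weakly-skew circuits)] -/
theorem ne_of_isSeparateOperand_of_pair' (hwf : P.WellFormed) {δ β γ : ℕ}
    (hg : P.gates[δ]? = some (.prod [.gate β, .gate γ])) (hsep : P.IsSeparateOperand δ β) :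
    β ≠ γ := by
  intro hβγ
  subst hβγ
  exact ne_of_isSeparateOperand_of_pair P hwf hg hsep rfl

/-- The other factor of a product gate lies OUTSIDE the module of its separate operand
(well-formed case; from `disjoint_subcircuit_of_isSeparateOperand`).
[cite: BurgisserEtAl2011, §9.1 (weakly-skew circuits)] -/
theorem not_mem_subcircuit_of_isSeparateOperand_of_references (hwf : P.WellFormed) {δ β γ : ℕ}
    (hsep : P.IsSeparateOperand δ γ) (hδγ : P.References δ γ) (hδβ : P.References δ β)
    (hne : β ≠ γ) : β ∉ P.subcircuit γ := fun hβ =>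
  Set.disjoint_left.1 (disjoint_subcircuit_of_isSeparateOperand P hwf hsep hδγ hδβ hne) hβ
    (self_mem_subcircuit P β)

end Laminar

end ArithCircuit

/-! ## Truncation: w.l.o.g. the output is the last gate (BLMW 2011 §9.1 hygiene)

Cutting a well-formed circuit after any gate keeps it well formed, fan-in-two and WEAKLY SKEW
(sub-circuits below the cut are unchanged, so separateness transfers); hence every well-formed
fan-in-two weakly-skew circuit can be replaced by one of at most the same size computing the same
polynomial whose output is an input operand over NO gates or the LAST gate — the normal form in
which the output gate lies in no separate module. [cite: BurgisserEtAl2011, §9.1 (weakly-skew circuits)] -/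

namespace ArithCircuit

section Truncate

variable {k : Type*} {σ : Type*} (P : ArithCircuit k σ)

/-- References of a prefix circuit: those of `P` issued from gates below the cut.
[cite: Burgisser2000, Def. 2.1] -/
theorem references_take_iff (n : ℕ) (u : Operand k σ) (l m : ℕ) :
    ({ gates := P.gates.take n, output := u } : ArithCircuit k σ).References l m ↔
      l < n ∧ P.References l m := by
  constructor
  · rintro ⟨g, hg, hm⟩
    have hl : l < n := by
      have h := (List.getElem?_eq_some_iff.1 hg).1
      rw [List.length_take] at h
      omega
    refine ⟨hl, g, ?_, hm⟩
    rwa [List.getElem?_take_of_lt hl] at hg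
  · rintro ⟨hl, g, hg, hm⟩
    exact ⟨g, by rwa [List.getElem?_take_of_lt hl], hm⟩

/-- Below the cut, the sub-circuits of a prefix of a well-formed circuit are those of the circuit.
[cite: BurgisserEtAl2011, §9.1 (the subcircuit C_α)] -/
theorem subcircuit_take_eq (hwf : P.WellFormed) {n β : ℕ} (hβ : β < n) (u : Operand k σ) :
    ({ gates := P.gates.take n, output := u } : ArithCircuit k σ).subcircuit β = P.subcircuit β := by
  ext l
  constructor
  · intro h
    change Relation.ReflTransGen _ _ _ at h
    induction h with
    | refl => exact self_mem_subcircuit P β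
    | tail _ hbc ih =>
      exact mem_subcircuit_of_references P ih ((references_take_iff P n u _ _).1 hbc).2
  · intro h
    change Relation.ReflTransGen _ _ _ at h
    induction h with
    | refl => exact Relation.ReflTransGen.refl
    | tail hab hbc ih =>
      refine Relation.ReflTransGen.tail ih ((references_take_iff P n u _ _).2 ⟨?_, hbc⟩)
      exact (subcircuit_le P hwf hab).trans_lt hβ

/-- Separateness transfers to a prefix circuit (the separate operand lying below the cut).
[cite: BurgisserEtAl2011, §9.1 (weakly-skew circuits)] -/
theorem isSeparateOperand_take (hwf : P.WellFormed) {n i β : ℕ} (hβ : β < n) (u : Operand k σ)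
    (hsep : P.IsSeparateOperand i β) :
    ({ gates := P.gates.take n, output := u } : ArithCircuit k σ).IsSeparateOperand i β := by
  intro l hl g hg j' hj'
  rw [subcircuit_take_eq P hwf hβ u] at hl hj'
  have hln : l < n := by
    have h := (List.getElem?_eq_some_iff.1 hg).1
    rw [List.length_take] at h
    omega
  rw [List.getElem?_take_of_lt hln] at hg
  exact hsep l hl g hg j' hj'

/-- **A prefix of a well-formed weakly-skew circuit is weakly skew.**
[cite: BurgisserEtAl2011, §9.1 (weakly-skew circuits)] -/
theorem isWeaklySkew_take (hwf : P.WellFormed) (hws : P.IsWeaklySkew) (n : ℕ) (u : Operand k σ) :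
    ({ gates := P.gates.take n, output := u } : ArithCircuit k σ).IsWeaklySkew := by
  intro i args hg hne
  have hin : i < n := by
    have h := (List.getElem?_eq_some_iff.1 hg).1
    rw [List.length_take] at h
    omega
  have hg' : P.gates[i]? = some (.prod args) := by rwa [List.getElem?_take_of_lt hin] at hg
  obtain ⟨v, hv, hcase⟩ := hws i args hg' hne
  refine ⟨v, hv, ?_⟩
  rcases hcase with hinp | ⟨β, rfl, hsep⟩
  · exact Or.inl hinp
  · refine Or.inr ⟨β, rfl, isSeparateOperand_take P hwf ?_ u hsep⟩
    have hβi : β < i := hwf.1 i _ hg' (.gate β) (by simpa [Gate.args] using hv)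
    exact hβi.trans hin

/-- A prefix of a fan-in-two circuit has fan-in two. [cite: Burgisser2000, Def. 2.1] -/
theorem isFanInTwo_take (h2 : P.IsFanInTwo) (n : ℕ) (u : Operand k σ) :
    ({ gates := P.gates.take n, output := u } : ArithCircuit k σ).IsFanInTwo :=
  fun g hg => h2 g (List.mem_of_mem_take hg)

/-- A prefix of a well-formed circuit, with an output reading below the cut, is well formed.
[cite: Burgisser2000, Def. 2.1] -/
theorem wellFormed_take (hwf : P.WellFormed) {n : ℕ} (hn : n ≤ P.size) {u : Operand k σ}
    (hu : u.RefsBelow n) :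
    ({ gates := P.gates.take n, output := u } : ArithCircuit k σ).WellFormed := by
  refine ⟨fun i g hg v hv => ?_, ?_⟩
  · have hin : i < n := by
      have h := (List.getElem?_eq_some_iff.1 hg).1
      rw [List.length_take] at h
      omega
    rw [List.getElem?_take_of_lt hin] at hg
    exact hwf.1 i g hg v hv
  · have hsize : ({ gates := P.gates.take n, output := u } : ArithCircuit k σ).size = n := by
      change (P.gates.take n).length = n
      rw [List.length_take]
      exact min_eq_left hn
    rw [hsize]
    exact hu

variable [CommSemiring k]

/-- The prefix cut after gate `j`, with output `gate j`, computes the value of gate `j`.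
[cite: Burgisser2000, Def. 2.1] -/
theorem eval_take_gate {j n : ℕ} (hj : j < n) :
    ({ gates := P.gates.take n, output := .gate j } : ArithCircuit k σ).eval =
      (gateValues P.gates).getD j 0 := by
  change (gateValues (P.gates.take n)).getD j 0 = _
  exact getD_gateValues_take P.gates hj

/-- **W.l.o.g. the output is the last gate.** Every well-formed fan-in-two weakly-skew circuit is
matched by one of at most the same size, still well formed, fan-in two and weakly skew, computing
the same polynomial, whose output operand is either an input over an EMPTY gate list or the last
gate. [cite: BurgisserEtAl2011, §9.1 (weakly-skew circuits)] -/
theorem exists_output_last (hwf : P.WellFormed) (h2 : P.IsFanInTwo) (hws : P.IsWeaklySkew) :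
    ∃ Q : ArithCircuit k σ, Q.WellFormed ∧ Q.IsFanInTwo ∧ Q.IsWeaklySkew ∧ Q.eval = P.eval ∧
      Q.size ≤ P.size ∧
      ((Q.gates = [] ∧ Q.output.isGateRef = false) ∨ Q.output = .gate (Q.size - 1)) := by
  rcases ho : P.output with i | c | j
  · refine ⟨{ gates := [], output := .var i }, ⟨fun i g hg => by simp at hg, trivial⟩,
      fun g hg => by simp at hg, fun i args hg => by simp at hg, ?_, Nat.zero_le _,
      Or.inl ⟨rfl, rfl⟩⟩
    simp [ArithCircuit.eval, ho, Operand.eval]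
  · refine ⟨{ gates := [], output := .const c }, ⟨fun i g hg => by simp at hg, trivial⟩,
      fun g hg => by simp at hg, fun i args hg => by simp at hg, ?_, Nat.zero_le _,
      Or.inl ⟨rfl, rfl⟩⟩
    simp [ArithCircuit.eval, ho, Operand.eval]
  · have hj : j < P.size := by have h := hwf.2; rw [ho] at h; exact h
    refine ⟨{ gates := P.gates.take (j + 1), output := .gate j },
      wellFormed_take P hwf hj (show j < j + 1 by omega), isFanInTwo_take P h2 _ _,
      isWeaklySkew_take P hwf hws _ _, ?_, ?_, Or.inr ?_⟩
    · rw [eval_take_gate P (Nat.lt_succ_self j)]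
      simp [ArithCircuit.eval, ho, Operand.eval]
    · change (P.gates.take (j + 1)).length ≤ P.gates.length
      rw [List.length_take]
      exact min_le_right _ _
    · change Operand.gate j = Operand.gate ((P.gates.take (j + 1)).length - 1)
      rw [List.length_take, min_eq_left (show j + 1 ≤ P.gates.length from hj)]
      rfl

end Truncate

end ArithCircuit

end Literature.Computability.AlgebraicComplexity
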